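import Literature.MathematicalPhysics.QuantumFieldTheory.Balaban1983to89.B10Eq27TorusAxialLog
import Literature.MathematicalPhysics.QuantumFieldTheory.Balaban1983to89.LatticeWordStokes
import Literature.MathematicalPhysics.QuantumFieldTheory.Balaban1983to89.T3PrintedRegularMinimiser
import Literature.MathematicalPhysics.QuantumFieldTheory.Balaban1983to89.B5Eq118OneStroke
import Literature.MathematicalPhysics.QuantumFieldTheory.Balaban1983to89.B15DeterminingSets
import HarnessLib

/-!
# Route `UnitScaleTilt`, crux K1 child «MinimiserStabilityRegPr» (stmt-QuantumFields-19200), registered stub `stub_prop7From14` (skeleton birth_v7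
# cc37a178…; leaf V3 «Prop 7 from a background (14)») — THE COMB-AXIAL (4)-REPRESENTATIVE RELATIVE TO A BACKGROUND IS `η`-SMALL ON THE
# INTERIOR BONDS OF EVERY BLOCK, `k`-UNIFORMLY: `|W_b U₀,b⁻¹ − 1| ≤ |b₋ − y|₁·(δ_W + δ_{U₀})` ([Balaban1985Averaging] pp. 24–25, [Balaban1985RegularSpaces]
# p. 79 «|V′_b − 1| < (d−1)(L−1)²α₀L⁻²  for b ⊂ B(y)», relative form)

Cell `ym3-torus` ∕ fleet seat `ym-ust-19200-p1` (gen 7; HUMAN RULING D-0037, YM ladder rung R3).  WHY.  Print's reduction of Proposition 7 (leaf V3) to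
the chart (19)–(21) starts, INSIDE the group (4) «u(y) = 1 for y ∈ 𝔅_k», from the axial gauge `Ax_k(𝔅_k, U₀)` ([Balaban1985Variational] (18) p. 280),
and the first estimate consumed by [Balaban1985RegularSpaces] Thm 2 (its Lemma 1, pp. 79–80) is the sup-smallness of the axial representative's perturbation
`V′ = WU₀⁻¹` on the bonds INSIDE a block: the tree-gauge mechanism of [Balaban1985Averaging] pp. 24–25 («The conditions V₀(Γ_{y,x}) = 1 imply V₀(x, x+e₁) = 1,
|V₀(x, x+e₂) − 1| < |x₁ − y₁|α₀, …»).  The companion file `…Prop7AxialGauge` (this seat) produces the comb-axial (4)-representative; THIS FILE bounds it: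
for two configurations `W, U₀` of ANY torus of the `Setup` tower with plaquette variables within `δ_W`, `δ₀` of `1`, if `W` and `U₀` have the same
holonomy along the combs `Γ_{y,x}`, `Γ_{y,x+e_μ}` from a base `y` (the axial gauge RELATIVE to `U₀` at the two endpoints of the bond `b = ⟨x, μ⟩`), then
`dist1(W_b·U₀,b⁻¹) ≤ |x − y|₁·(δ_W + δ₀)` — the AREA of the comb fan, not the squared length.  At the item's carrier (plaquette clause of print's (2):
`δ = e·L^{−2(K−n)}`, and `|x − y|₁ ≤ O(d)·L^{K−n}` inside a `(K−n)`-block) this is the `k`-UNIFORM `O(ε₀η)` sup bound on the interior bonds.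

WHAT IS PROVED (sorry-free, no definition; `holT`∕`axialT`∕`contourT` = `B10Eq27TorusAxialLog`, `treeWord`∕`seg`∕`l1` = `B7Prop1Explicit`, `walk`∕`holAt`∕
`wordRev` = `T4Continuum`∕`BlockAveraging`, the transposition calculus = `LatticeWordStokes`).
* §1 `revWord_eq_wordRev` (the two reversal letters of the tree agree); **`dist1_holAt_combLoop_le`** — THE COMB-FAN STOKES BOUND: under `PlaqSmall δ U`,
  `dist1 𝒰_y(Γ_{y,y+v} ∪ [μ] ∪ −Γ_{y,y+v+e_μ}) ≤ |v|₁·δ` (one leftward cancellation of the letter `±e_μ` through the tail of the comb: `LatticeWordStokes.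
  dist1_holAt_cancel_le`; the rest of the word backtracks exactly).
* §2 **`dist1_mul_inv_le_of_axial`** — THE RELATIVE AXIAL BOUND ON ONE BOND: `axialT W y x = axialT U₀ y x`, the same at `x + e_μ`, no wrap-around at the
  bond ⟹ `dist1 (W_b U₀,b⁻¹) ≤ |x − y|₁·(δ_W + δ₀)`; the algebra `W_bU₀,b⁻¹ = H₀(x)⁻¹·[𝒰_W(ω_b)·𝒰_{U₀}(ω_b)⁻¹]·H₀(x)` is `mul_inv_eq_conj_of_axial`.
* §3 **`dist1_mul_inv_le_of_combAxial`** — for the complete `k`-fold comb axial gauge of `…Prop7AxialGauge` (same comb holonomies as `U₀` from the centre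
  `embIter k (iterBlockOf k x)` of every site's `k`-block) and a bond whose endpoints lie in ONE `k`-block.
* §4 `dist1_mul_inv_le_of_combAxial_T3` — read at the d = 3 carrier with print's plaquette clause of (2) (`RegPr.plaqSmall`, threshold
  `regThreshold F n K e = e·L^{−2(K−n)}`): `dist1(W_bU₀,b⁻¹) ≤ |x − y|₁·(e_W + e₀)·L^{−2(K−n)}`.

HONEST SCOPE.  Interior (same-block, non-wrapping) bonds only: the bonds joining two `k`-blocks are controlled in print by the AVERAGING constraint (both
configurations in `𝔅_k(V)`) — [Balaban1985RegularSpaces] Lemma 1 (1.24)–(1.26), second half — not attempted here (`-- TODO(general form): (1.25) on the bonds of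
B_j(c), c ∈ Λ_j, from |V̄′ − V̄₀′| < α₁`).  The `ℓ¹`-length `|x − y|₁` of the relative position is kept symbolic (inside a `k`-block it is at most
`d·(L^k − 1)`, not proved here).  Nothing of [Balaban1985RegularSpaces] Thm 2 is claimed.

References: T. Bałaban, CMP 98 (1985) 17–51 [Balaban1985Averaging] ((8)–(9) pp.18–19, (19)–(20) p.21, pp.24–25); CMP 99 (1985) 75–102 [Balaban1985RegularSpaces]
((1.19) p.79, Lemma 1 (1.24)–(1.25) p.79); CMP 102 (1985) 277–309 [Balaban1985Variational] ((2), (4) p.278, (18) p.280).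
-/

noncomputable section

namespace Summit.QuantumFields.YangMills.Theorems.Prop7AxialGaugeSup

open Literature.MathematicalPhysics.QuantumFieldTheory.Balaban1983to89
open T4Continuum T4ReflectionCone BlockAveraging LatticeWordStokes
open B10Eq27TorusAxialLog (holT axialT gaugeActT transl rel contourT holT_eq_holAt contourT_eq holT_contourT axialT_self)
open B7Prop1Explicit (treeWord seg revWord l1 e length_treeWord flatMap_congr_of)
open B5Eq118OneStroke (iterBlockOf)
open B15DeterminingSets (embIter)

/-! ## §1 The comb-fan Stokes bound -/

section Stokes

variable {P : Params} {j : ℕ} {G : Type*} [GaugeGroup G]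

/-- The two word reversals of the tree agree (`B7Prop1Explicit.revWord` = `BlockAveraging.wordRev`; letters `Fin d × Bool`). [cite: Balaban1985Averaging, (7) p.18] -/
theorem revWord_eq_wordRev {d : ℕ} (w : List (B7Prop1Explicit.Letter d)) : revWord w = wordRev w := by
  induction w with
  | nil => rfl
  | cons l w ih =>
    obtain ⟨μ, b⟩ := l
    rw [wordRev_cons, ← ih]
    simp [revWord, Letter.flip]

/-- A word followed by its reversal has trivial holonomy. [cite: Balaban1985Averaging, (7) and (9) pp.18-19] -/
theorem holAt_walk_append_wordRev (U : GaugeField P j G) (x : Site P j) (X C : List (Letter P.d)) :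
    holAt U (walk x (X ++ (wordRev X ++ C))) = holAt U (walk x C) := by
  rw [walk_append, holAt_append, walk_append, holAt_append, holAt_walk_wordRev, walkEnd_walkEnd_wordRev, mul_inv_cancel_left]

/-- `seg κ (m+1) = seg κ m ++ [+e_κ]` for `m ≥ 0`. [cite: Balaban1984PropagatorsI, (1.7) p.18] -/
theorem seg_natCast_succ {d : ℕ} (κ : Fin d) (m : ℕ) : seg κ ((m : ℤ) + 1) = seg κ m ++ [(κ, true)] := by
  rw [show ((m : ℤ) + 1) = ((m + 1 : ℕ) : ℤ) by push_cast; ring, B7Prop1Explicit.seg_natCast, B7Prop1Explicit.seg_natCast,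
    List.replicate_succ']

/-- `seg κ (−(m+1)) = seg κ (−m) ++ [−e_κ]`. [cite: Balaban1984PropagatorsI, (1.7) p.18] -/
theorem seg_neg_succ {d : ℕ} (κ : Fin d) (m : ℕ) : seg κ (-((m : ℤ) + 1)) = seg κ (-(m : ℤ)) ++ [(κ, false)] := by
  rw [show (-((m : ℤ) + 1)) = -((m + 1 : ℕ) : ℤ) by push_cast; ring, B7Prop1Explicit.seg_neg_natCast, B7Prop1Explicit.seg_neg_natCast,
    List.replicate_succ']

/-- **THE COMB-FAN STOKES BOUND.**  If every plaquette variable of `U` is within `δ ≥ 0` of `1`, then for every base site `y`, every relative position `v`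
and direction `μ`, the holonomy of the closed word `Γ_{y,y+v} ∪ [y+v, y+v+e_μ] ∪ (−Γ_{y,y+v+e_μ})` (comb out, one step, comb back) is within `|v|₁·δ` of `1`.
Mechanism ([Balaban1985Averaging] pp. 24–25, made quantitative by `LatticeWordStokes`): the two combs share the segments of the directions processed before
`μ`; the step `±e_μ` is moved through the later segments at one plaquette per transposition (`dist1_holAt_cancel_le`), after which the word backtracks.
[cite: Balaban1985Averaging, pp.24-25; Balaban1985RegularSpaces, p.79] -/
theorem dist1_holAt_combLoop_le (U : GaugeField P j G) {δ : ℝ} (hδ : 0 ≤ δ) (hU : PlaqSmall δ U) (y : Site P j)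
    (v : B7Prop1Explicit.Site P.d) (μ : Fin P.d) :
    dist1 (holAt U (walk y (treeWord v ++ [(μ, true)] ++ wordRev (treeWord (v + e μ))))) ≤ (l1 v : ℝ) * δ := by
  -- split the comb at the segment of direction `μ` (as in `B7Prop1Explicit.axial_bond_eq`)
  obtain ⟨s, t, hst⟩ := List.append_of_mem (a := μ) (l := (List.finRange P.d).reverse) (by simp)
  have hnd : (s ++ μ :: t).Nodup := by
    rw [← hst]; exact List.nodup_reverse.mpr (List.nodup_finRange P.d)
  have hμst : μ ∉ s ++ t := (List.nodup_cons.mp (List.nodup_middle.mp hnd)).1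
  rw [List.mem_append, not_or] at hμst
  let f : Fin P.d → List (B7Prop1Explicit.Letter P.d) := fun κ => seg κ (v κ)
  have hne : ∀ κ, κ ≠ μ → seg κ ((v + e μ) κ) = f κ := by
    intro κ hκ; simp [f, e, hκ]
  have hμμ : seg μ ((v + e μ) μ) = seg μ (v μ + 1) := by simp [e]
  have h1 : treeWord v = s.flatMap f ++ (seg μ (v μ) ++ t.flatMap f) := by
    rw [treeWord, hst, List.flatMap_append, List.flatMap_cons]
  have h2 : treeWord (v + e μ) = s.flatMap f ++ (seg μ (v μ + 1) ++ t.flatMap f) := by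
    rw [treeWord, hst, List.flatMap_append, List.flatMap_cons, hμμ,
      flatMap_congr_of (s := s) (fun κ hκ => hne κ (fun h => hμst.1 (h ▸ hκ))),
      flatMap_congr_of (s := t) (fun κ hκ => hne κ (fun h => hμst.2 (h ▸ hκ)))]
  set A := s.flatMap f with hA
  set B := t.flatMap f with hB
  -- `|B| ≤ |v|₁`
  have hBlen : (B.length : ℝ) ≤ l1 v := by
    have h : B.length ≤ (treeWord v).length := by rw [h1]; simp; omega
    rw [length_treeWord] at h
    exact_mod_cast h
  have hrevlen : ((wordRev B).length : ℝ) = B.length := by simp [wordRev]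
  rcases Int.eq_nat_or_neg (v μ) with ⟨m, hm | hm⟩
  · -- `v_μ = m ≥ 0`: the returning comb is one `+e_μ` longer
    rw [h1, h2, hm, seg_natCast_succ, wordRev_append, wordRev_append, wordRev_append]
    have hrw : s.flatMap f ++ (seg μ ↑m ++ B) ++ [(μ, true)] ++ (wordRev B ++ (wordRev [(μ, true)] ++ wordRev (seg μ ↑m)) ++ wordRev A) =
        (A ++ seg μ m ++ B) ++ (μ, true) :: (wordRev B ++ (Letter.flip (μ, true)) :: (wordRev (seg μ m) ++ wordRev A)) := by
      simp [wordRev_cons, Letter.flip, hA]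
    rw [hrw]
    refine (dist1_holAt_cancel_le U hδ hU y (μ, true) (wordRev B) (A ++ seg μ m ++ B) (wordRev (seg μ m) ++ wordRev A)).trans ?_
    have hX : A ++ seg μ ↑m ++ B ++ (wordRev B ++ (wordRev (seg μ ↑m) ++ wordRev A)) =
        (A ++ seg μ m ++ B) ++ (wordRev (A ++ seg μ m ++ B) ++ []) := by simp [wordRev_append]
    rw [hX, holAt_walk_append_wordRev]
    simp only [walk, holAt_nil, GaugeGroup.dist1_one, add_zero, hrevlen]
    exact mul_le_mul_of_nonneg_right hBlen hδ
  · -- `v_μ = −m ≤ 0`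
    cases m with
    | zero =>
      -- `v_μ = 0`: same as the first case with `m = 0`
      simp only [Nat.cast_zero, neg_zero] at hm
      rw [h1, h2, hm, show (0 : ℤ) = ((0 : ℕ) : ℤ) by simp, seg_natCast_succ, wordRev_append, wordRev_append, wordRev_append]
      have hrw : s.flatMap f ++ (seg μ ((0 : ℕ) : ℤ) ++ B) ++ [(μ, true)] ++
            (wordRev B ++ (wordRev [(μ, true)] ++ wordRev (seg μ ((0 : ℕ) : ℤ))) ++ wordRev A) =
          (A ++ seg μ ((0 : ℕ) : ℤ) ++ B) ++ (μ, true) :: (wordRev B ++ (Letter.flip (μ, true)) :: (wordRev (seg μ ((0 : ℕ) : ℤ)) ++ wordRev A)) := by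
        simp [wordRev_cons, Letter.flip, hA]
      rw [hrw]
      refine (dist1_holAt_cancel_le U hδ hU y (μ, true) (wordRev B) (A ++ seg μ ((0 : ℕ) : ℤ) ++ B)
        (wordRev (seg μ ((0 : ℕ) : ℤ)) ++ wordRev A)).trans ?_
      have hX : A ++ seg μ ((0 : ℕ) : ℤ) ++ B ++ (wordRev B ++ (wordRev (seg μ ((0 : ℕ) : ℤ)) ++ wordRev A)) =
          (A ++ seg μ ((0 : ℕ) : ℤ) ++ B) ++ (wordRev (A ++ seg μ ((0 : ℕ) : ℤ) ++ B) ++ []) := by simp [wordRev_append]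
      rw [hX, holAt_walk_append_wordRev]
      simp only [walk, holAt_nil, GaugeGroup.dist1_one, add_zero, hrevlen]
      exact mul_le_mul_of_nonneg_right hBlen hδ
    | succ m =>
      -- `v_μ = −(m+1) < 0`: the outgoing comb is one `−e_μ` longer
      have hm' : v μ = -((m : ℤ) + 1) := by rw [hm]; push_cast; ring
      have hsucc : v μ + 1 = -(m : ℤ) := by rw [hm']; ring
      rw [h1, h2, hsucc, hm', seg_neg_succ, wordRev_append, wordRev_append]
      have hrw : s.flatMap f ++ (seg μ (-(m : ℤ)) ++ [(μ, false)] ++ B) ++ [(μ, true)] ++ (wordRev B ++ wordRev (seg μ (-(m : ℤ))) ++ wordRev A) =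
          (A ++ seg μ (-(m : ℤ))) ++ (μ, false) :: (B ++ (Letter.flip (μ, false)) :: (wordRev B ++ wordRev (seg μ (-(m : ℤ))) ++ wordRev A)) := by
        simp [Letter.flip, hA]
      rw [hrw]
      refine (dist1_holAt_cancel_le U hδ hU y (μ, false) B (A ++ seg μ (-(m : ℤ)))
        (wordRev B ++ wordRev (seg μ (-(m : ℤ))) ++ wordRev A)).trans ?_
      have hX : A ++ seg μ (-(m : ℤ)) ++ (B ++ (wordRev B ++ wordRev (seg μ (-(m : ℤ))) ++ wordRev A)) =
          (A ++ seg μ (-(m : ℤ)) ++ B) ++ (wordRev (A ++ seg μ (-(m : ℤ)) ++ B) ++ []) := by simp [wordRev_append]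
      rw [hX, holAt_walk_append_wordRev]
      simp only [walk, holAt_nil, GaugeGroup.dist1_one, add_zero]
      exact mul_le_mul_of_nonneg_right hBlen hδ

end Stokes

/-! ## §2 The relative axial bound on one bond -/

section Relative

variable {P : Params} {j : ℕ} {G : Type*} [GaugeGroup G]

/-- ALGEBRA OF THE RELATIVE AXIAL GAUGE: if `W` and `U₀` have the same comb holonomies from `y` to both endpoints of the non-wrapping bond `b = ⟨x, μ⟩`, then
`W_b·U₀,b⁻¹ = U₀(Γ_{y,x})⁻¹·[W(ω_b)·U₀(ω_b)⁻¹]·U₀(Γ_{y,x})`, `ω_b = Γ_{y,x} ∪ b ∪ (−Γ_{y,x+e_μ})` the comb loop through `b`.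
[cite: Balaban1985Averaging, pp.24-25; Balaban1985RegularSpaces, (1.19) p.79] -/
theorem mul_inv_eq_conj_of_axial (W U₀ : GaugeField P j G) (y x : Site P j) (μ : Fin P.d)
    (hwrap : (rel y x μ + 1) * 2 ≤ (P.sitesPerDir j : ℤ))
    (hax : axialT W y x = axialT U₀ y x) (hax' : axialT W y (x.shift μ) = axialT U₀ y (x.shift μ)) :
    W ⟨x, μ⟩ * (U₀ ⟨x, μ⟩)⁻¹ =
      (axialT U₀ y x)⁻¹ * (holT W y (contourT y ⟨x, μ⟩) * (holT U₀ y (contourT y ⟨x, μ⟩))⁻¹) * axialT U₀ y x := by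
  have hW := holT_contourT W y ⟨x, μ⟩ hwrap
  have hU := holT_contourT U₀ y ⟨x, μ⟩ hwrap
  simp only [PBond.tgt] at hW hU
  rw [hW, hU, hax, hax']
  group

/-- **THE RELATIVE AXIAL BOUND ON ONE BOND** ([Balaban1985Averaging] pp. 24–25 ∕ [Balaban1985RegularSpaces] p. 79, relative form): plaquette variables of `W`,
`U₀` within `δ_W, δ₀ ≥ 0` of `1`, the same comb holonomies from `y` at both endpoints of the non-wrapping bond `⟨x, μ⟩` ⟹
`dist1(W_b·U₀,b⁻¹) ≤ |x − y|₁·(δ_W + δ₀)`. [cite: Balaban1985Averaging, pp.24-25; Balaban1985RegularSpaces, Lemma 1 p.79] -/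
theorem dist1_mul_inv_le_of_axial (W U₀ : GaugeField P j G) {δW δ₀ : ℝ} (hδW : 0 ≤ δW) (hδ₀ : 0 ≤ δ₀)
    (hW : PlaqSmall δW W) (hU₀ : PlaqSmall δ₀ U₀) (y x : Site P j) (μ : Fin P.d)
    (hwrap : (rel y x μ + 1) * 2 ≤ (P.sitesPerDir j : ℤ))
    (hax : axialT W y x = axialT U₀ y x) (hax' : axialT W y (x.shift μ) = axialT U₀ y (x.shift μ)) :
    dist1 (W ⟨x, μ⟩ * (U₀ ⟨x, μ⟩)⁻¹) ≤ (l1 (rel y x) : ℝ) * (δW + δ₀) := by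
  rw [mul_inv_eq_conj_of_axial W U₀ y x μ hwrap hax hax']
  have hconj : dist1 ((axialT U₀ y x)⁻¹ * (holT W y (contourT y ⟨x, μ⟩) * (holT U₀ y (contourT y ⟨x, μ⟩))⁻¹) * axialT U₀ y x) =
      dist1 (holT W y (contourT y ⟨x, μ⟩) * (holT U₀ y (contourT y ⟨x, μ⟩))⁻¹) := by
    have h := GaugeGroup.dist1_conj (holT W y (contourT y ⟨x, μ⟩) * (holT U₀ y (contourT y ⟨x, μ⟩))⁻¹) (axialT U₀ y x)⁻¹
    rwa [inv_inv] at h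
  rw [hconj]
  have hloopW : dist1 (holT W y (contourT y ⟨x, μ⟩)) ≤ (l1 (rel y x) : ℝ) * δW := by
    rw [holT_eq_holAt, contourT_eq, revWord_eq_wordRev]
    exact dist1_holAt_combLoop_le W hδW hW y (rel y x) μ
  have hloopU : dist1 (holT U₀ y (contourT y ⟨x, μ⟩)) ≤ (l1 (rel y x) : ℝ) * δ₀ := by
    rw [holT_eq_holAt, contourT_eq, revWord_eq_wordRev]
    exact dist1_holAt_combLoop_le U₀ hδ₀ hU₀ y (rel y x) μ
  calc dist1 (holT W y (contourT y ⟨x, μ⟩) * (holT U₀ y (contourT y ⟨x, μ⟩))⁻¹)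
      ≤ dist1 (holT W y (contourT y ⟨x, μ⟩)) + dist1 ((holT U₀ y (contourT y ⟨x, μ⟩))⁻¹) := GaugeGroup.dist1_mul_le _ _
    _ = dist1 (holT W y (contourT y ⟨x, μ⟩)) + dist1 (holT U₀ y (contourT y ⟨x, μ⟩)) := by rw [GaugeGroup.dist1_inv]
    _ ≤ (l1 (rel y x) : ℝ) * δW + (l1 (rel y x) : ℝ) * δ₀ := add_le_add hloopW hloopU
    _ = (l1 (rel y x) : ℝ) * (δW + δ₀) := by ring

end Relative

/-! ## §3 For the complete `k`-fold comb axial gauge of `…Prop7AxialGauge`: interior bonds of a block -/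

section Comb

variable {P : Params} {G : Type*} [GaugeGroup G]

/-- **INTERIOR BONDS OF A `k`-BLOCK**: if `W` is in the complete `k`-fold comb axial gauge relative to `U₀` (same comb holonomies from the centre of every
site's `k`-block — the gauge of `Prop7AxialGauge.exists_axialGauge`), both are `δ`-regular in the plaquette sense, and the bond `⟨x, μ⟩` has both endpoints
in one `k`-block and does not wrap around the torus, then `dist1(W_bU₀,b⁻¹) ≤ |x − y(x)|₁·(δ_W + δ₀)`, `y(x)` the centre of the block.
[cite: Balaban1985RegularSpaces, Lemma 1 (1.25) p.79 («for b ⊂ B(y)»); Balaban1985Averaging, pp.24-25] -/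
theorem dist1_mul_inv_le_of_combAxial {k : ℕ} (W U₀ : GaugeField P 0 G) {δW δ₀ : ℝ} (hδW : 0 ≤ δW) (hδ₀ : 0 ≤ δ₀)
    (hW : PlaqSmall δW W) (hU₀ : PlaqSmall δ₀ U₀)
    (hax : ∀ x : Site P 0, axialT W (embIter k (iterBlockOf k x)) x = axialT U₀ (embIter k (iterBlockOf k x)) x)
    (x : Site P 0) (μ : Fin P.d) (hblock : iterBlockOf k (x.shift μ) = iterBlockOf k x)
    (hwrap : (rel (embIter k (iterBlockOf k x)) x μ + 1) * 2 ≤ (P.sitesPerDir 0 : ℤ)) :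
    dist1 (W ⟨x, μ⟩ * (U₀ ⟨x, μ⟩)⁻¹) ≤ (l1 (rel (embIter k (iterBlockOf k x)) x) : ℝ) * (δW + δ₀) := by
  refine dist1_mul_inv_le_of_axial W U₀ hδW hδ₀ hW hU₀ _ x μ hwrap (hax x) ?_
  have h := hax (x.shift μ)
  rwa [hblock] at h

end Comb

/-! ## §4 At the d = 3 carrier of the item: print's plaquette clause of (2) -/

section T3

open Literature.MathematicalPhysics.QuantumFieldTheory.Balaban1983to89.T3ContinuumYM3Torus
open Literature.MathematicalPhysics.QuantumFieldTheory.Balaban1983to89.T3RegularMinimiser (regThreshold)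
open Literature.MathematicalPhysics.QuantumFieldTheory.Balaban1983to89.T3PrintedRegularMinimiser (RegPr RegPr.plaqSmall)

variable (F : T3Family) (n K : ℕ)

/-- **THE `k`-UNIFORM INTERIOR SUP BOUND AT THE CARRIER**: `W ∈ 𝔘_k(e_W)`, `U₀ ∈ 𝔘_k(e₀)` (print's (2); only the plaquette clause
`dist1 U(∂p) < e·L^{−2(K−n)}` is used), `W` in the complete `(K−n)`-fold comb axial gauge relative to `U₀`, bond inside one `(K−n)`-block, no wrap ⟹
`dist1(W_bU₀,b⁻¹) ≤ |x − y(x)|₁·(e_W + e₀)·L^{−2(K−n)}` — with `|x − y(x)|₁ = O(d·L^{K−n})` this is `O(ε₀)·L^{−(K−n)} = O(ε₀η)`, uniformly in `K − n`.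
[cite: Balaban1985Variational, (2) p.278; Balaban1985RegularSpaces, Lemma 1 (1.25) p.79] -/
theorem dist1_mul_inv_le_of_combAxial_T3 {eW e₀ : ℝ} (heW : 0 ≤ eW) (he₀ : 0 ≤ e₀)
    (W U₀ : GaugeField (F.P K) 0 (Matrix.specialUnitaryGroup (Fin 2) ℂ)) (hW : RegPr F n K eW W) (hU₀ : RegPr F n K e₀ U₀)
    (hax : ∀ x : Site (F.P K) 0, axialT W (embIter (K - n) (iterBlockOf (K - n) x)) x = axialT U₀ (embIter (K - n) (iterBlockOf (K - n) x)) x)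
    (x : Site (F.P K) 0) (μ : Fin (F.P K).d) (hblock : iterBlockOf (K - n) (x.shift μ) = iterBlockOf (K - n) x)
    (hwrap : (rel (embIter (K - n) (iterBlockOf (K - n) x)) x μ + 1) * 2 ≤ ((F.P K).sitesPerDir 0 : ℤ)) :
    dist1 (W ⟨x, μ⟩ * (U₀ ⟨x, μ⟩)⁻¹) ≤
      (l1 (rel (embIter (K - n) (iterBlockOf (K - n) x)) x) : ℝ) * ((eW + e₀) * (((F.L : ℝ))⁻¹) ^ (2 * (K - n))) := by
  have hpos : 0 ≤ (((F.L : ℝ))⁻¹) ^ (2 * (K - n)) := pow_nonneg (inv_nonneg.mpr (Nat.cast_nonneg _)) _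
  have h := dist1_mul_inv_le_of_combAxial (k := K - n) W U₀ (mul_nonneg heW hpos) (mul_nonneg he₀ hpos)
    (RegPr.plaqSmall hW) (RegPr.plaqSmall hU₀) hax x μ hblock hwrap
  calc dist1 (W ⟨x, μ⟩ * (U₀ ⟨x, μ⟩)⁻¹)
      ≤ (l1 (rel (embIter (K - n) (iterBlockOf (K - n) x)) x) : ℝ) * (regThreshold F n K eW + regThreshold F n K e₀) := h
    _ = (l1 (rel (embIter (K - n) (iterBlockOf (K - n) x)) x) : ℝ) * ((eW + e₀) * (((F.L : ℝ))⁻¹) ^ (2 * (K - n))) := by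
        unfold regThreshold; ring

end T3

end Summit.QuantumFields.YangMills.Theorems.Prop7AxialGaugeSup

end
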